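import Summits.AtomisticToContinuum.BoseEinsteinCondensation.Theorems.BECRichardsonGaudinRichardsonAnchorBECPenalisedLowerBoundCore
import HarnessLib

/-!
# Crux `RichardsonAnchorBEC` (stmt-AtomisticToContinuum-14805), line `registered` — the condensate-penalised lower bound

`stub_penalisedLowerBound` (former stub L): for `γ, Λ > 0` there is `ϑ > 0` (`ϑ = γJ_*/(1+γJ_*)`, `J_* = Λ/(12π³)`)
such that for every `ε > 0`, `ρ ∈ (0,1)` and all large `N = n+2` (`L ≥ 4π/Λ`, `n ≥ 1`, `N ≥ 1/(2εϑ)`), EVERY periodic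
trial state satisfies `e_ref + ϑργ(1−ε)N ≤ E_Δ(Φ) + ϑργ·n₀(Φ)` (`Δ = 2ργ`, `e_ref = bornEnergy`): the eventual
bookkeeping around `stub_lowerBoundCore` (the sums-of-squares assembly of the landed P1, P2, P3, P5, P6).
No smallness of `ρ` is needed (ρ₀ = 1).
-/

noncomputable section

namespace Summit.AtomisticToContinuum.BoseEinsteinCondensation.Cruxes.RichardsonAnchorBEC.Birth

open MeasureTheory Filter
open scoped ENNReal NNReal
open Literature.MathematicalPhysics.QuantumManyBody.BoseGas
open Summit.AtomisticToContinuum.BoseEinsteinCondensation.Theses.BECRichardsonGaudin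

/-- **The condensate-penalised lower bound for the Richardson anchor** (registered statement
`stub_penalisedLowerBound` of crux stmt-AtomisticToContinuum-14805, former stub L of line `registered`): for
`γ, Λ > 0` put `J_* = Λ/(12π³)`, `ϑ = γJ_*/(1+γJ_*)`, `ρ₀ = 1`; for `ρ ∈ (0,1)` and `n` with `L = (N/ρ)^{1/3} ≥ 4π/Λ`,
`n ≥ 1` and `N ≥ 1/(2εϑ)`, every `Φ` satisfies `e_ref + ϑργ(1−ε)N ≤ E_Δ(Φ) + ϑργ·n₀(Φ)` — by `stub_lowerBoundCore` (the sums
of squares 1–4 of the module docstring, i.e. the landed `stub_pairSquareLower`, `stub_crossTermLower`,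
`stub_bandKineticLower`, `stub_condensatePairJensen`) at `κ = (2−ϑ)ργ ≥ 2D₀` (from `jstar_le_bandBubble`, i.e. the
landed `stub_bandBubbleLower`), after splitting the shift `E_Δ + λn₀ = E_κ + λN`. [folklore] -/
theorem stub_penalisedLowerBound :
    ∀ γ Λ : ℝ, 0 < γ → 0 < Λ → ∃ ϑ : ℝ, 0 < ϑ ∧ ∀ ε : ℝ, 0 < ε → ∃ ρ₀ : ℝ, 0 < ρ₀ ∧
      ∀ ρ : ℝ, 0 < ρ → ρ < ρ₀ → ∀ᶠ n : ℕ in Filter.atTop,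
        ∀ Φ : PeriodicTrialState (n + 2) (sideLength ρ (n + 2)),
          ENNReal.ofReal (bornEnergy γ ρ n Λ + ϑ * (ρ * γ) * (1 - ε) * ((n + 2 : ℕ) : ℝ)) ≤
            anchorE γ (2 * ρ * γ) ρ n Λ Φ +
              ENNReal.ofReal (ϑ * (ρ * γ)) * condensateOccupation (n + 2) (sideLength ρ (n + 2)) Φ.ψ := by
  intro γ Λ hγ hΛ
  have hπ := Real.pi_pos
  set Js : ℝ := Λ / (12 * Real.pi ^ 3) with hJs_def
  have hJs : 0 < Js := by rw [hJs_def]; positivity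
  refine ⟨γ * Js / (1 + γ * Js), by positivity, fun ε hε => ⟨1, one_pos, fun ρ hρ _ => ?_⟩⟩
  set ϑ : ℝ := γ * Js / (1 + γ * Js) with hϑ_def
  have hϑ0 : 0 < ϑ := by rw [hϑ_def]; positivity
  have hev₁ : ∀ᶠ n : ℕ in atTop, ρ * (4 * Real.pi / Λ) ^ 3 ≤ ((n + 2 : ℕ) : ℝ) := by
    filter_upwards [(tendsto_natCast_atTop_atTop (R := ℝ)).eventually_ge_atTop
      (ρ * (4 * Real.pi / Λ) ^ 3)] with n hn
    push_cast
    linarith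
  have hev₃ : ∀ᶠ n : ℕ in atTop, 1 / (2 * ε * ϑ) ≤ ((n + 2 : ℕ) : ℝ) := by
    filter_upwards [(tendsto_natCast_atTop_atTop (R := ℝ)).eventually_ge_atTop (1 / (2 * ε * ϑ))] with n hn
    push_cast
    linarith
  filter_upwards [hev₁, eventually_ge_atTop 1, hev₃] with n hE1 hE2 hE3
  intro Φ
  have hL : 0 < sideLength ρ (n + 2) := Real.rpow_pos_of_pos (div_pos (by positivity) hρ) _
  have hL3 : sideLength ρ (n + 2) ^ 3 = ((n + 2 : ℕ) : ℝ) / ρ := sideLength_pow_three hρ (n + 2)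
  have hLΛ : 4 * Real.pi / Λ ≤ sideLength ρ (n + 2) := by
    refine le_of_pow_le_pow_left₀ three_ne_zero hL.le ?_
    rw [hL3, le_div_iff₀ hρ]
    linarith
  have hJ := jstar_le_bandBubble hΛ hL hLΛ
  have hJ0 : 0 ≤ bandBubble (sideLength ρ (n + 2)) ⌊Λ * sideLength ρ (n + 2) / (2 * Real.pi)⌋₊ :=
    hJs.le.trans hJ
  have hϑJ : ϑ ≤ γ * bandBubble (sideLength ρ (n + 2)) ⌊Λ * sideLength ρ (n + 2) / (2 * Real.pi)⌋₊ /
      (1 + γ * bandBubble (sideLength ρ (n + 2)) ⌊Λ * sideLength ρ (n + 2) / (2 * Real.pi)⌋₊) := by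
    rw [hϑ_def, div_le_div_iff₀ (by positivity) (by positivity)]
    nlinarith [mul_le_mul_of_nonneg_left hJ hγ.le]
  rw [anchorE_eq,
    (stub_bandKineticLower (sideLength ρ (n + 2)) γ n ⌊Λ * sideLength ρ (n + 2) / (2 * Real.pi)⌋₊ hL hγ.le Φ).2.2]
  unfold bornEnergy
  exact stub_lowerBoundCore _ hL hγ hρ hε hL3 hE2 hϑ0 hJ0 hϑJ hE3 Φ


end Summit.AtomisticToContinuum.BoseEinsteinCondensation.Cruxes.RichardsonAnchorBEC.Birth

end
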